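import Summits.ValiantsHypothesis.ValiantsHypothesis.Theorems.NewtonUnitEquationsTwoProductsSubmergedTruncation
import Summits.ValiantsHypothesis.ValiantsHypothesis.Theorems.TwoProducts.Negative.CommonPadding

/-!
# K4 `submerged-band-filtration` — witnesses: tie-free perturbation (strict letter order) and the tied-letters cell (`#S ≤ 1`)

Tool file for the reduction `SubmergedReduction` (val-idea-36 g0's L2).  The band filtration assigns a visible point `l` of a cell to
the truncation by the letters STRICTLY below `l` at its witness `ξ`; `l` is then submerged only if no remaining letter is TIED with `l`
(`wt ξ e = wt ξ l`, `e ≠ l`) — and at a tie the deletion of the tied floor letter can un-cancel it (explicit `m = 3` instances exist), so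
ties must be avoided by the CHOICE of the witness.  Two facts make this possible:
* `exists_tieFree_witness`: if the cell's letter order is STRICT at `ξ` (no two distinct letters tied), a small perturbation
  `ξ + ε η` (`η = (1, √2)`, whose weight is injective on `ℕ²`) is still valid, still exposes `l` (strict tops of the finite support
  `supp(∏(1+u) − ∏(1+v))` are open conditions; log-support via the landed `stub_logLinearisation`), induces the same order on the letters,
  and ties no letter with `l`;
* `card_le_one_of_letter_tie`: if the cell order `R` ties two DISTINCT letters, every witness is orthogonal to their (nonzero) difference,
  so all witnesses are positively proportional (`ℝ²`!) and the cell has at most one visible point.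
Helper mode (`--supports stmt-ValiantsHypothesis-5906 --as helper`).  Honest framing: infrastructure for an exact reduction of the per-cell
law to submerged cells; nothing here closes 5906 (`TwoProducts` / `ResidualLawV23` / `PlanarCellBound` OPEN); VP ≠ VNP is NOT proved.
(Tail letters are negative for valid weights: landed `Negative.CommonPadding.wt_neg_of_mem_tailSupport`, imported.)  No instances, no
notation, no named facts. [folklore]
-/

noncomputable section
set_option linter.dupNamespace false

namespace Summit.ValiantsHypothesis.ValiantsHypothesis.Theorems.NewtonUnitEquations.TwoProducts.Submerged
open scoped BigOperators
open MvPolynomial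
open Summit.ValiantsHypothesis.ValiantsHypothesis.Theorems.NewtonUnitEquations.TwoProducts.FormalLogLinearisation
open Summit.ValiantsHypothesis.ValiantsHypothesis.Theorems.NewtonUnitEquations.TwoProducts.PlanarCell
open Summit.ValiantsHypothesis.Theorems.TwoProducts.Negative.CommonPadding (wt_neg_of_mem_tailSupport)

variable {m : ℕ}

/-! ## Elementary facts on weights -/

/-- Weights are affine in the weight vector: `wt (ξ + ε η) x = wt ξ x + ε · wt η x`. [folklore] -/
theorem wt_add_smul (ξ η : Fin 2 → ℝ) (ε : ℝ) (x : Expo) : wt (ξ + ε • η) x = wt ξ x + ε * wt η x := by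
  simp only [wt, Pi.add_apply, Pi.smul_apply, smul_eq_mul]
  ring

/-- There is a weight vector whose weight function is injective on `ℕ²` (e.g. `(1, √2)`). [folklore] -/
theorem exists_wt_injective : ∃ η : Fin 2 → ℝ, ∀ x y : Expo, wt η x = wt η y → x = y := by
  refine ⟨fun i => if i = 0 then 1 else Real.sqrt 2, fun x y h => ?_⟩
  have h' : ((x 0 : ℕ) : ℝ) + Real.sqrt 2 * ((x 1 : ℕ) : ℝ) = ((y 0 : ℕ) : ℝ) + Real.sqrt 2 * ((y 1 : ℕ) : ℝ) := by
    simpa [wt] using h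
  by_cases h1 : x 1 = y 1
  · have h0 : ((x 0 : ℕ) : ℝ) = ((y 0 : ℕ) : ℝ) := by
      rw [h1] at h'; linarith
    have h0' : x 0 = y 0 := by exact_mod_cast h0
    ext i
    fin_cases i
    · exact h0'
    · exact h1
  · exfalso
    have hk : (((y 1 : ℕ) : ℤ) - ((x 1 : ℕ) : ℤ) : ℤ) ≠ 0 := by
      intro hz
      apply h1
      have : ((y 1 : ℕ) : ℤ) = ((x 1 : ℕ) : ℤ) := by linarith
      exact_mod_cast this.symm
    have hirr : Irrational (Real.sqrt 2 * ((((y 1 : ℕ) : ℤ) - ((x 1 : ℕ) : ℤ) : ℤ) : ℝ)) :=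
      irrational_sqrt_two.mul_intCast hk
    have hrat : Real.sqrt 2 * ((((y 1 : ℕ) : ℤ) - ((x 1 : ℕ) : ℤ) : ℤ) : ℝ) =
        ((((x 0 : ℕ) : ℤ) - ((y 0 : ℕ) : ℤ) : ℤ) : ℝ) := by
      push_cast
      linarith
    rw [hrat] at hirr
    exact hirr.ne_int _ rfl

/-- Finitely many strict linear constraints survive every sufficiently small perturbation. [folklore] -/
theorem exists_eps_of_finset {ι : Type*} (s : Finset ι) (g h : ι → ℝ) (hg : ∀ i ∈ s, g i < 0) :
    ∃ ε : ℝ, 0 < ε ∧ ∀ ε' : ℝ, 0 < ε' → ε' ≤ ε → ∀ i ∈ s, g i + ε' * h i < 0 := by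
  classical
  induction s using Finset.induction_on with
  | empty => exact ⟨1, one_pos, by simp⟩
  | insert a s ha ih =>
    obtain ⟨ε₁, hε₁, hs⟩ := ih fun i hi => hg i (Finset.mem_insert_of_mem hi)
    have hga : g a < 0 := hg a (Finset.mem_insert_self a s)
    by_cases hha : h a ≤ 0
    · refine ⟨ε₁, hε₁, fun ε' hε' hle i hi => ?_⟩
      rcases Finset.mem_insert.1 hi with rfl | hi
      · nlinarith
      · exact hs ε' hε' hle i hi
    · push Not at hha
      refine ⟨min ε₁ (-g a / (2 * h a)), lt_min hε₁ (div_pos (by linarith) (by linarith)), fun ε' hε' hle i hi => ?_⟩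
      rcases Finset.mem_insert.1 hi with rfl | hi
      · have h2 : ε' ≤ -g i / (2 * h i) := hle.trans (min_le_right _ _)
        have h3 : ε' * h i ≤ -g i / (2 * h i) * h i := mul_le_mul_of_nonneg_right h2 hha.le
        have h4 : -g i / (2 * h i) * h i = -g i / 2 := by field_simp
        linarith
      · exact hs ε' hε' (hle.trans (min_le_left _ _)) i hi

/-! ## Tie-free witnesses -/

/-- **TIE-FREE WITNESS.**  If the valid weight `ξ` exposes `l` (strict top of the log-support) and ties no two distinct tail letters, then
some valid weight `ξ'` exposes `l`, induces the same order on the tail letters, and ties NO letter with `l`. [folklore] -/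
theorem exists_tieFree_witness (u v : Fin m → MvPolynomial (Fin 2) ℂ) (hu0 : ∀ j, coeff 0 (u j) = 0)
    (hv0 : ∀ j, coeff 0 (v j) = 0) (ξ : Fin 2 → ℝ) (hξ : ValidWeight u v ξ) (l : Expo)
    (hl : IsStrictTop ξ (logSupport u v) l)
    (hinj : ∀ e ∈ tailSupport u v, ∀ e' ∈ tailSupport u v, wt ξ e = wt ξ e' → e = e') :
    ∃ ξ' : Fin 2 → ℝ, ValidWeight u v ξ' ∧ IsStrictTop ξ' (logSupport u v) l ∧
      (∀ e ∈ tailSupport u v, ∀ e' ∈ tailSupport u v, (wt ξ e ≤ wt ξ e' ↔ wt ξ' e ≤ wt ξ' e')) ∧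
      ∀ e ∈ tailSupport u v, e ≠ l → wt ξ' e ≠ wt ξ' l := by
  classical
  set T := tailSupport u v with hT
  have hF : IsStrictTop ξ (↑(tailDiff u v).support) l := (stub_logLinearisation m u v hu0 hv0 ξ hξ l).2 hl
  obtain ⟨η, hη⟩ := exists_wt_injective
  -- the finite family of strict constraints `wt ξ p < wt ξ q` to be preserved
  set C : Finset (Expo × Expo) :=
    T.image (fun e => (e, (0 : Expo))) ∪ ((tailDiff u v).support.erase l).image (fun μ => (μ, l)) ∪
      ((insert l T) ×ˢ (insert l T)).filter (fun pq => wt ξ pq.1 < wt ξ pq.2) with hC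
  have hCg : ∀ c ∈ C, wt ξ c.1 - wt ξ c.2 < 0 := by
    intro c hc
    rcases Finset.mem_union.1 hc with hc | hc
    · rcases Finset.mem_union.1 hc with hc | hc
      · obtain ⟨e, he, rfl⟩ := Finset.mem_image.1 hc
        simp only [wt_zero, sub_zero]
        exact wt_neg_of_mem_tailSupport hξ he
      · obtain ⟨μ, hμ, rfl⟩ := Finset.mem_image.1 hc
        have h := hF.2 μ (Finset.mem_coe.2 (Finset.mem_of_mem_erase hμ)) (Finset.ne_of_mem_erase hμ)
        simp only
        linarith
    · have h := (Finset.mem_filter.1 hc).2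
      linarith
  obtain ⟨ε, hε, hεC⟩ := exists_eps_of_finset C (fun c => wt ξ c.1 - wt ξ c.2) (fun c => wt η c.1 - wt η c.2) hCg
  set ξ' : Fin 2 → ℝ := ξ + ε • η with hξ'
  -- the perturbed comparison of a constrained pair stays strict
  have hlt : ∀ p q : Expo, (p, q) ∈ C → wt ξ' p < wt ξ' q := by
    intro p q hpq
    have h := hεC ε hε le_rfl (p, q) hpq
    simp only at h
    rw [hξ', wt_add_smul, wt_add_smul]
    linarith
  have hmemV : ∀ e ∈ T, (e, (0 : Expo)) ∈ C := fun e he =>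
    Finset.mem_union_left _ (Finset.mem_union_left _ (Finset.mem_image.2 ⟨e, he, rfl⟩))
  have hmemS : ∀ μ ∈ (tailDiff u v).support, μ ≠ l → (μ, l) ∈ C := fun μ hμ hne =>
    Finset.mem_union_left _ (Finset.mem_union_right _ (Finset.mem_image.2 ⟨μ, Finset.mem_erase.2 ⟨hne, hμ⟩, rfl⟩))
  have hmemO : ∀ p ∈ insert l T, ∀ q ∈ insert l T, wt ξ p < wt ξ q → (p, q) ∈ C := fun p hp q hq hpq =>
    Finset.mem_union_right _ (Finset.mem_filter.2 ⟨Finset.mem_product.2 ⟨hp, hq⟩, hpq⟩)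
  -- validity
  have hval' : ValidWeight u v ξ' := by
    have key : ∀ e ∈ T, wt ξ' e < 0 := fun e he => by
      have h := hlt e 0 (hmemV e he)
      rwa [wt_zero] at h
    refine ⟨fun j e he => key e ?_, fun j e he => key e ?_⟩
    · exact Finset.mem_union_left _ (Finset.mem_biUnion.2 ⟨j, Finset.mem_univ j, he⟩)
    · exact Finset.mem_union_right _ (Finset.mem_biUnion.2 ⟨j, Finset.mem_univ j, he⟩)
  refine ⟨ξ', hval', ?_, ?_, ?_⟩
  · -- `l` stays the strict top
    have hF' : IsStrictTop ξ' (↑(tailDiff u v).support) l :=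
      ⟨hF.1, fun μ hμ hne => hlt μ l (hmemS μ (Finset.mem_coe.1 hμ) hne)⟩
    exact (stub_logLinearisation m u v hu0 hv0 ξ' hval' l).1 hF'
  · -- same order on the letters
    intro e he e' he'
    constructor
    · intro hle
      rcases hle.lt_or_eq with hlt' | heq
      · exact (hlt e e' (hmemO e (Finset.mem_insert_of_mem he) e' (Finset.mem_insert_of_mem he') hlt')).le
      · rw [hinj e he e' he' heq]
    · intro hle'
      by_contra hgt
      push Not at hgt
      have := hlt e' e (hmemO e' (Finset.mem_insert_of_mem he') e (Finset.mem_insert_of_mem he) hgt)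
      linarith
  · -- no letter is tied with `l`
    intro e he hne heq
    rcases lt_trichotomy (wt ξ e) (wt ξ l) with h | h | h
    · have := hlt e l (hmemO e (Finset.mem_insert_of_mem he) l (Finset.mem_insert_self l T) h)
      linarith
    · have h2 : wt η e = wt η l := by
        have h3 : wt ξ' e - wt ξ' l = ε * (wt η e - wt η l) := by rw [hξ', wt_add_smul, wt_add_smul, h]; ring
        have h4 : ε * (wt η e - wt η l) = 0 := by rw [← h3, heq, sub_self]
        rcases mul_eq_zero.1 h4 with h5 | h5
        · exact absurd h5 hε.ne'
        · linarith
      exact hne (hη e l h2)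
    · have := hlt l e (hmemO l (Finset.mem_insert_self l T) e (Finset.mem_insert_of_mem he) h)
      linarith

/-! ## The tied-letters cell -/

/-- Two weight vectors orthogonal to the same nonzero integer direction are parallel: all `2 × 2` minors of their weights vanish.
[folklore] -/
theorem wt_mul_wt_eq_of_tie (ξ ξ' : Fin 2 → ℝ) (e₁ e₂ : Expo) (hne : e₁ ≠ e₂) (h : wt ξ e₁ = wt ξ e₂)
    (h' : wt ξ' e₁ = wt ξ' e₂) (x y : Expo) : wt ξ' x * wt ξ y = wt ξ x * wt ξ' y := by
  -- the direction `d = e₁ − e₂` (real coordinates) is nonzero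
  have hd : (((e₁ 0 : ℕ) : ℝ) - ((e₂ 0 : ℕ) : ℝ)) ≠ 0 ∨ (((e₁ 1 : ℕ) : ℝ) - ((e₂ 1 : ℕ) : ℝ)) ≠ 0 := by
    by_contra hcon
    push Not at hcon
    apply hne
    ext i
    fin_cases i
    · exact_mod_cast (sub_eq_zero.1 hcon.1)
    · exact_mod_cast (sub_eq_zero.1 hcon.2)
  have h1 : ξ 0 * (((e₁ 0 : ℕ) : ℝ) - ((e₂ 0 : ℕ) : ℝ)) + ξ 1 * (((e₁ 1 : ℕ) : ℝ) - ((e₂ 1 : ℕ) : ℝ)) = 0 := by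
    simp only [wt] at h; linarith
  have h2 : ξ' 0 * (((e₁ 0 : ℕ) : ℝ) - ((e₂ 0 : ℕ) : ℝ)) + ξ' 1 * (((e₁ 1 : ℕ) : ℝ) - ((e₂ 1 : ℕ) : ℝ)) = 0 := by
    simp only [wt] at h'; linarith
  -- the cross product `ξ × ξ'` vanishes
  have hκ : ξ 0 * ξ' 1 - ξ 1 * ξ' 0 = 0 := by
    rcases hd with hd | hd
    · have : (ξ 0 * ξ' 1 - ξ 1 * ξ' 0) * (((e₁ 0 : ℕ) : ℝ) - ((e₂ 0 : ℕ) : ℝ)) = 0 := by linear_combination ξ' 1 * h1 - ξ 1 * h2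
      exact (mul_eq_zero.1 this).resolve_right hd
    · have : (ξ 0 * ξ' 1 - ξ 1 * ξ' 0) * (((e₁ 1 : ℕ) : ℝ) - ((e₂ 1 : ℕ) : ℝ)) = 0 := by linear_combination ξ 0 * h2 - ξ' 0 * h1
      exact (mul_eq_zero.1 this).resolve_right hd
  simp only [wt]
  linear_combination (((x 1 : ℕ) : ℝ) * ((y 0 : ℕ) : ℝ) - ((x 0 : ℕ) : ℝ) * ((y 1 : ℕ) : ℝ)) * hκ

/-- **THE TIED-LETTERS CELL.**  If the cell order `R` ties two distinct tail letters, the cell family has at most one point: all its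
witnesses are positively proportional, and a set has at most one strict top for proportional weights. [folklore] -/
theorem card_le_one_of_letter_tie (u v : Fin m → MvPolynomial (Fin 2) ℂ) (R : Expo → Expo → Prop) (S : Finset Expo)
    (hS : IsCellFamily u v R S) {e₁ e₂ : Expo} (he₁ : e₁ ∈ tailSupport u v) (he₂ : e₂ ∈ tailSupport u v)
    (hne : e₁ ≠ e₂) (h12 : R e₁ e₂) (h21 : R e₂ e₁) : S.card ≤ 1 := by
  refine Finset.card_le_one.2 fun l hl l' hl' => ?_
  obtain ⟨ξ, hξ, htop, hR⟩ := hS l hl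
  obtain ⟨ξ', hξ', htop', hR'⟩ := hS l' hl'
  have ht : wt ξ e₁ = wt ξ e₂ := le_antisymm ((hR e₁ he₁ e₂ he₂).1 h12) ((hR e₂ he₂ e₁ he₁).1 h21)
  have ht' : wt ξ' e₁ = wt ξ' e₂ := le_antisymm ((hR' e₁ he₁ e₂ he₂).1 h12) ((hR' e₂ he₂ e₁ he₁).1 h21)
  have hα : wt ξ e₁ < 0 := wt_neg_of_mem_tailSupport hξ he₁
  have hα' : wt ξ' e₁ < 0 := wt_neg_of_mem_tailSupport hξ' he₁
  have P := wt_mul_wt_eq_of_tie ξ ξ' e₁ e₂ hne ht ht'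
  by_contra hll
  have h1 : wt ξ l' < wt ξ l := htop.2 l' htop'.1 (Ne.symm hll)
  have h2 : wt ξ' l < wt ξ' l' := htop'.2 l htop.1 hll
  have P1 := P l e₁
  have P2 := P l' e₁
  nlinarith

end Summit.ValiantsHypothesis.ValiantsHypothesis.Theorems.NewtonUnitEquations.TwoProducts.Submerged

end
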